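import Summits.CriticalPhenomena.PercolationContinuityZ3.Theorems.PercNearOneGluingNoHeavyRsw3SlabPlateRenormalization
import HarnessLib

/-!
# RSW3 lane (P2, gen 11): PLATE GLUING AND RENORMALISATION at every integer aspect `k ≥ 6` — near-certain crossings of the plates
# `{0..2n} × {0..n} × {0..kn}` glued by near-certain uniqueness of the slabs `{0..n} × {0..kn}²` percolate (range `k`)

builds on p205010 (kernel theorem, internal audit signed; external expert review pending)

Cell `prim-rsw3`, prover seat `prim-rsw3-p2` (gen 11), memo `run/shared/lean/prim/rsw3/P2-RSWLITE.md` §17.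
Support file (`--supports stmt-CriticalPhenomena-4575`); no definitions, no named facts, no sorries.  The `k`-general form of
`…Rsw3SlabPlateGluing` / `…Rsw3SlabPlateRenormalization` (`k = 6`): cells `b ∈ ℤ²`, plates `(n b₀, 2n b₁, 0) + {0..2n} × {0..n} × {0..kn}` crossed
along `x₀`, slabs `(n b₀ + n, 2n b₁ - 2n, 0) + Icc 0 (easyShape k n)` with unique spanning clusters; `★`-adjacent regular cells glue
(`reachable_of_slabUniq_plates_general`: an `x₀`-crossing of a neighbouring plate contains a spanning crossing of the slab, `kn ≥ 5n`);
footprints `(n b₀, 2n b₁ - 2n, 0) + {0..2n} × {0..kn}²` are disjoint at sup-distance `> k`; the witness-form `★`-Peierls criterion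
`theta_pos_of_sparse_bound_wit` with range `r = k` gives, for every `p`, `k ≥ 6`, `n ≥ 1`:

  `theta_pos_of_plate_slabUniq_criterion_general`:  `P_p((boxCross (2n, n, kn) 0)ᶜ) + P_p(TwoSpan({0..n} × {0..kn}²)) ≤ δ_k^{(k+1)²} ⇒ θ(p) > 0`,
  `δ_k = 1/(2·((k+1)²+2)·(2·(3²+1)²)^{(k+1)²})`.

References: M. Aizenman, Nucl. Phys. B 485 (1997) 551–582, §2 Thm. 2 and criterion (ii) [Aizenman1997]; G. Grimmett, *Percolation* (1999),
§1.6, §2.2, §7.4 [GrimmettPercolation1999]. [folklore]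
-/

noncomputable section

namespace Summit.CriticalPhenomena.PercolationContinuityZ3.Theorems.Rsw3

open MeasureTheory Literature.Probability.LatticeModels Literature.Probability.Percolation
open Literature.Probability.Percolation.KestenZhang Literature.Probability.Percolation.KozmaNitzan SimpleGraph Relation
open Summit.CriticalPhenomena.PercolationContinuityZ3.Theorems.Crossing SurfaceTension

/-! ## Plate crossings are spanning crossings of the rotated slab: the gluing step -/

/-- **Slab uniqueness glues plate crossings, aspect `k ≥ 6`** (`k`-general form of `reachable_of_slabUniq_plates`): with plates
`(k₀,k₁,0) + {0..2n}×{0..n}×{0..kn}`, `(k₀',k₁',0) + …` (`k₀ ≤ k₀' ≤ k₀+n`, `|k₁'−k₁| ≤ 2n`) and the slab `β = (k₀+n, k₁−2n, 0) + {0..n}×{0..kn}²`,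
uniqueness of the spanning paths of `β` joins the starting points of any two `x₀`-crossings of the plates (each contains a sub-path spanning `β`).
[cite: Aizenman1997, §2 (proof of Thm. 2: chains of regular cells glue their spanning clusters)] -/
theorem reachable_of_slabUniq_plates_general {k n : ℕ} (hk : 6 ≤ k) {k₀ k₀' k₁ k₁' : ℤ} (hk₀ : k₀ ≤ k₀')
    (hk₀' : k₀' ≤ k₀ + n)
    (hk₁ : k₁ - 2 * (n : ℤ) ≤ k₁') (hk₁' : k₁' ≤ k₁ + 2 * (n : ℤ)) {ω : BondConfig (Site 3)}
    (hU : ω ∈ {ω : BondConfig (Site 3) |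
      ∀ x ∈ (Finset.Icc (0 : Site 3) (easyShape k n)).image (· + ![k₀ + n, k₁ - 2 * (n : ℤ), 0]),
      ∀ x' ∈ (Finset.Icc (0 : Site 3) (easyShape k n)).image (· + ![k₀ + n, k₁ - 2 * (n : ℤ), 0]),
      ∀ y ∈ (Finset.Icc (0 : Site 3) (easyShape k n)).image (· + ![k₀ + n, k₁ - 2 * (n : ℤ), 0]),
      ∀ y' ∈ (Finset.Icc (0 : Site 3) (easyShape k n)).image (· + ![k₀ + n, k₁ - 2 * (n : ℤ), 0]),
        x 0 = k₀ + n → x' 0 = k₀ + n → y 0 = k₀ + n + (n : ℤ) → y' 0 = k₀ + n + (n : ℤ) →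
        ω ∈ inConn ↑((Finset.Icc (0 : Site 3) (easyShape k n)).image (· + ![k₀ + n, k₁ - 2 * (n : ℤ), 0])) x y →
        ω ∈ inConn ↑((Finset.Icc (0 : Site 3) (easyShape k n)).image (· + ![k₀ + n, k₁ - 2 * (n : ℤ), 0])) x' y' →
        ω ∈ inConn ↑((Finset.Icc (0 : Site 3) (easyShape k n)).image (· + ![k₀ + n, k₁ - 2 * (n : ℤ), 0])) x x'})
    {x y x' y' : Site 3} (hx0 : x 0 = k₀) (hy0 : y 0 = k₀ + 2 * (n : ℤ)) (hx'0 : x' 0 = k₀') (hy'0 : y' 0 = k₀' + 2 * (n : ℤ))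
    (hx : x ∈ (Finset.Icc (0 : Site 3) ![2 * (n : ℤ), n, (k : ℤ) * (n : ℤ)]).image (· + ![k₀, k₁, 0]))
    (hx' : x' ∈ (Finset.Icc (0 : Site 3) ![2 * (n : ℤ), n, (k : ℤ) * (n : ℤ)]).image (· + ![k₀', k₁', 0]))
    (hxy : ω ∈ inConn ↑((Finset.Icc (0 : Site 3) ![2 * (n : ℤ), n, (k : ℤ) * (n : ℤ)]).image (· + ![k₀, k₁, 0])) x y)
    (hx'y' : ω ∈ inConn ↑((Finset.Icc (0 : Site 3) ![2 * (n : ℤ), n, (k : ℤ) * (n : ℤ)]).image (· + ![k₀', k₁', 0])) x' y') :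
    (openGraph ω).Reachable x x' := by
  classical
  set β : Finset (Site 3) := (Finset.Icc (0 : Site 3) (easyShape k n)).image (· + ![k₀ + n, k₁ - 2 * (n : ℤ), 0]) with hβ
  set ℓ₁ : ℤ := k₀ + n with hℓ₁
  set ℓ₂ : ℤ := k₀ + 2 * (n : ℤ) with hℓ₂
  have hn0 : (0 : ℤ) ≤ n := by positivity
  have hkn : 6 * (n : ℤ) ≤ (k : ℤ) * (n : ℤ) := mul_le_mul_of_nonneg_right (by exact_mod_cast hk) hn0
  -- membership in `β` from the coordinates
  have hmemβ : ∀ z : Site 3, ℓ₁ ≤ z 0 → z 0 ≤ ℓ₂ → k₁ - 2 * (n : ℤ) ≤ z 1 → z 1 ≤ k₁ + 4 * (n : ℤ) →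
      0 ≤ z 2 → z 2 ≤ (k : ℤ) * (n : ℤ) → z ∈ β := by
    intro z h1 h2 h3 h4 h5 h6
    rw [hβ, mem_image_Icc_add_iff]
    intro j
    fin_cases j
    · simp [easyShape]; constructor <;> omega
    · simp [easyShape]; constructor <;> omega
    · simp [easyShape]; omega
  -- a sub-walk of a plate crossing inside `β`
  have hplate : ∀ {κ₀ κ₁ : ℤ} {u w : Site 3}, k₀ ≤ κ₀ → κ₀ ≤ k₀ + n → k₁ - 2 * (n : ℤ) ≤ κ₁ → κ₁ ≤ k₁ + 2 * (n : ℤ) →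
      u 0 = κ₀ → w 0 = κ₀ + 2 * (n : ℤ) →
      u ∈ (Finset.Icc (0 : Site 3) ![2 * (n : ℤ), n, (k : ℤ) * (n : ℤ)]).image (· + ![κ₀, κ₁, 0]) →
      ω ∈ inConn ↑((Finset.Icc (0 : Site 3) ![2 * (n : ℤ), n, (k : ℤ) * (n : ℤ)]).image (· + ![κ₀, κ₁, 0])) u w →
      ∃ q r : Site 3, q ∈ β ∧ r ∈ β ∧ q 0 = ℓ₁ ∧ r 0 = ℓ₂ ∧ (openGraph ω).Reachable u q ∧ ω ∈ inConn ↑β q r := by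
    intro κ₀ κ₁ u w h1 h2 h3 h4 hu0 hw0 hu huw
    set Pl : Finset (Site 3) := (Finset.Icc (0 : Site 3) ![2 * (n : ℤ), n, (k : ℤ) * (n : ℤ)]).image (· + ![κ₀, κ₁, 0]) with hPl
    rw [mem_inConn_iff] at huw
    obtain ⟨Wk⟩ := huw
    have hHle : openGraph ω ⊓ withinGraph (zdGraph 3) (↑Pl : Set (Site 3)) ≤ zdGraph 3 :=
      fun a b hab => (withinGraph_adj.1 hab.2).1
    have hHS : openGraph ω ⊓ withinGraph (zdGraph 3) (↑Pl : Set (Site 3)) ≤ withinGraph (zdGraph 3) ↑Pl := inf_le_right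
    obtain ⟨q, r, hq, hr, haq, hqr⟩ := exists_subwalk_between_levels hHle Wk 0 (ℓ₁ := ℓ₁) (ℓ₂ := ℓ₂)
      (by rw [hu0, hℓ₁]; omega) (by rw [hℓ₁, hℓ₂]; omega) (by rw [hw0, hℓ₂]; omega)
    -- all vertices involved lie in the plate
    have hmemPl : ∀ {z : Site 3}, z ∈ Pl → (κ₀ ≤ z 0 ∧ z 0 ≤ κ₀ + 2 * (n : ℤ)) ∧ (κ₁ ≤ z 1 ∧ z 1 ≤ κ₁ + n) ∧
        (0 ≤ z 2 ∧ z 2 ≤ (k : ℤ) * (n : ℤ)) := by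
      intro z hz
      rw [hPl, mem_image_Icc_add_iff] at hz
      have a0 := hz 0; have a1 := hz 1; have a2 := hz 2
      simp at a0 a1 a2
      exact ⟨⟨a0.1, by linarith⟩, ⟨a1.1, by linarith⟩, ⟨a2.1, by linarith⟩⟩
    have hqPl : q ∈ Pl := by
      obtain ⟨W₁⟩ := haq
      have := getVert_mem_of_le_withinGraph hHS W₁ (Finset.mem_coe.2 hu) W₁.length
      rwa [W₁.getVert_length, Finset.mem_coe] at this
    have hsub : (↑Pl : Set (Site 3)) ∩ {z : Site 3 | ℓ₁ ≤ z 0 ∧ z 0 ≤ ℓ₂} ⊆ ↑β := by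
      rintro z ⟨hz, hz1, hz2⟩
      rw [Finset.mem_coe] at hz ⊢
      obtain ⟨-, ⟨b1, b2⟩, ⟨c1, c2⟩⟩ := hmemPl hz
      exact hmemβ z hz1 hz2 (by omega) (by omega) c1 c2
    have hle : openGraph ω ⊓ withinGraph (zdGraph 3) (↑Pl : Set (Site 3)) ⊓
          withinGraph (zdGraph 3) {z : Site 3 | ℓ₁ ≤ z 0 ∧ z 0 ≤ ℓ₂} ≤
        openGraph ω ⊓ withinGraph (zdGraph 3) (↑β : Set (Site 3)) := by
      intro a b hab
      obtain ⟨⟨hopen, hPl'⟩, hlev⟩ := hab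
      rw [withinGraph_adj] at hPl' hlev
      refine ⟨hopen, ?_⟩
      rw [withinGraph_adj]
      exact ⟨hPl'.1, hsub ⟨hPl'.2.1, hlev.2.1⟩, hsub ⟨hPl'.2.2, hlev.2.2⟩⟩
    have hqβ : q ∈ β := by
      have := (hmemPl hqPl)
      exact hmemβ q (by rw [hq]) (by rw [hq, hℓ₁, hℓ₂]; omega) (by omega) (by omega) this.2.2.1 this.2.2.2
    have hrβ : r ∈ β := by
      rcases eq_or_ne q r with h | h
      · rw [← h]; exact hqβ
      · obtain ⟨W₂⟩ := hqr.mono hle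
        cases W₂ with
        | nil => exact absurd rfl h
        | cons hadj W₃ =>
          have := getVert_mem_of_le_withinGraph (inf_le_right : openGraph ω ⊓ withinGraph (zdGraph 3) (↑β : Set (Site 3)) ≤ _)
            W₃ (withinGraph_adj.1 hadj.2).2.2 W₃.length
          rwa [W₃.getVert_length, Finset.mem_coe] at this
    refine ⟨q, r, hqβ, hrβ, hq, hr, haq.mono inf_le_left, ?_⟩
    rw [mem_inConn_iff]
    exact hqr.mono hle
  -- the two sub-walks
  obtain ⟨q, r, hqβ, hrβ, hq, hr, hxq, hqr⟩ :=
    hplate le_rfl (by omega) (by omega) (by omega) hx0 hy0 hx hxy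
  obtain ⟨q', r', hq'β, hr'β, hq', hr', hx'q', hq'r'⟩ :=
    hplate hk₀ hk₀' hk₁ hk₁' hx'0 hy'0 hx' hx'y'
  -- uniqueness inside `β` joins `q` to `q'`
  have hℓ₂' : ℓ₂ = k₀ + n + (n : ℤ) := by rw [hℓ₂]; ring
  have hqq' := hU q hqβ q' hq'β r hrβ r' hr'β hq hq' (by rw [hr, hℓ₂']) (by rw [hr', hℓ₂']) hqr hq'r'
  rw [mem_inConn_iff] at hqq'
  exact (hxq.trans (hqq'.mono inf_le_left)).trans hx'q'.symm

/-! ## The renormalisation at aspect `k` -/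

/-- **Footprints of cells at sup-distance `> k` are disjoint**: the boxes `(n b₀, 2n b₁ - 2n, 0) + {0..2n} × {0..kn}²`, `n ≥ 1`, `k ≥ 6`. [folklore] -/
theorem disjoint_plateFootprint_of_lt_supDist_general {k n : ℕ} (hk : 6 ≤ k) (hn : 1 ≤ n) {b b' : Site 2}
    (h : k < supDist b b') :
    Disjoint ((Finset.Icc (0 : Site 3) ![2 * (n : ℤ), (k : ℤ) * (n : ℤ), (k : ℤ) * (n : ℤ)]).image
        (· + ![(n : ℤ) * b 0, 2 * (n : ℤ) * b 1 - 2 * (n : ℤ), 0]))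
      ((Finset.Icc (0 : Site 3) ![2 * (n : ℤ), (k : ℤ) * (n : ℤ), (k : ℤ) * (n : ℤ)]).image
        (· + ![(n : ℤ) * b' 0, 2 * (n : ℤ) * b' 1 - 2 * (n : ℤ), 0])) := by
  rw [Finset.disjoint_left]
  intro x hx hx'
  rw [mem_image_Icc_add_iff] at hx hx'
  have hn0 : (0 : ℤ) < n := by exact_mod_cast hn
  have hx0 := hx 0; have hx'0 := hx' 0; have hx1 := hx 1; have hx'1 := hx' 1
  simp at hx0 hx'0 hx1 hx'1
  have key0 : ∀ {c c' : ℤ}, (n : ℤ) * c ≤ 2 * (n : ℤ) + (n : ℤ) * c' → c ≤ c' + 2 := by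
    intro c c' h1
    by_contra hc
    push Not at hc
    have h3 : c' + 3 ≤ c := by omega
    nlinarith
  have hk' : (6 : ℤ) ≤ k := by exact_mod_cast hk
  have key1 : ∀ {c c' : ℤ}, 2 * (n : ℤ) * c - 2 * (n : ℤ) ≤ (k : ℤ) * (n : ℤ) + (2 * (n : ℤ) * c' - 2 * (n : ℤ)) → c ≤ c' + k := by
    intro c c' h1
    by_contra hc
    push Not at hc
    have h3 : c' + (k : ℤ) + 1 ≤ c := by omega
    nlinarith
  have a0 : b 0 ≤ b' 0 + 2 := key0 (by linarith [hx0.1, hx'0.2])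
  have a0' : b' 0 ≤ b 0 + 2 := key0 (by linarith [hx'0.1, hx0.2])
  have a1 : b 1 ≤ b' 1 + k := key1 (by linarith [hx1.1, hx'1.2])
  have a1' : b' 1 ≤ b 1 + k := key1 (by linarith [hx'1.1, hx1.2])
  have hle : supDist b b' ≤ k := by
    rw [supDist_le_iff]
    intro i
    fin_cases i
    · show (b 0 - b' 0).natAbs ≤ k; omega
    · show (b 1 - b' 1).natAbs ≤ k; omega
  omega

/-! ## The criterion -/

/-- **Plate renormalisation at aspect `k ≥ 6` (every `p`, every `n ≥ 1`).**  With `δ_k = 1/(2·((k+1)²+2)·(2·(3²+1)²)^{(k+1)²})`: if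
`P_p((boxCross (2n, n, kn) 0)ᶜ) + P_p(TwoSpan({0..n} × {0..kn}²)) ≤ δ_k^{(k+1)²}` then `θ(p) > 0` (cells as in the file header; range `k`;
`theta_pos_of_sparse_bound_wit`).  Aizenman's criterion (ii) without the thinness of the cells.
[cite: Aizenman1997, §2 criterion (ii) ("if (1 - R) + D is too small then there is percolation")] -/
theorem theta_pos_of_plate_slabUniq_criterion_general (p : unitInterval) {k n : ℕ} (hk : 6 ≤ k) (hn : 1 ≤ n)
    (h : (bondPercolation (zdGraph 3) p).real (boxCross ![2 * (n : ℤ), n, (k : ℤ) * (n : ℤ)] 0)ᶜ +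
        (bondPercolation (zdGraph 3) p).real
          {ω : BondConfig (Site 3) | ∃ x ∈ Finset.Icc (0 : Site 3) (easyShape k n), ∃ x' ∈ Finset.Icc (0 : Site 3) (easyShape k n),
            ∃ y ∈ Finset.Icc (0 : Site 3) (easyShape k n), ∃ y' ∈ Finset.Icc (0 : Site 3) (easyShape k n),
            x 0 = 0 ∧ x' 0 = 0 ∧ y 0 = (n : ℤ) ∧ y' 0 = (n : ℤ) ∧
            ω ∈ inConn ↑(Finset.Icc (0 : Site 3) (easyShape k n)) x y ∧
            ω ∈ inConn ↑(Finset.Icc (0 : Site 3) (easyShape k n)) x' y' ∧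
            ω ∉ inConn ↑(Finset.Icc (0 : Site 3) (easyShape k n)) x x'} ≤
      (1 / (2 * (((k : ℝ) + 1) ^ 2 + 2) * (2 * (3 ^ 2 + 1 : ℝ) ^ 2) ^ ((k + 1) ^ 2))) ^ ((k + 1) ^ 2)) :
    0 < theta (zdGraph 3) (0 : Site 3) p := by
  classical
  set μ := bondPercolation (zdGraph 3) p with hμ
  set δ : ℝ := 1 / (2 * (((k : ℝ) + 1) ^ 2 + 2) * (2 * (3 ^ 2 + 1 : ℝ) ^ 2) ^ ((k + 1) ^ 2)) with hδ
  have hn0 : (0 : ℤ) ≤ n := by positivity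
  have hn1 : (0 : ℤ) < n := by exact_mod_cast hn
  have hkn : 6 * (n : ℤ) ≤ (k : ℤ) * (n : ℤ) := mul_le_mul_of_nonneg_right (by exact_mod_cast hk) hn0
  -- base regions
  set L : Site 3 := ![2 * (n : ℤ), n, (k : ℤ) * (n : ℤ)] with hL
  set plate₀ : Finset (Site 3) := Finset.Icc (0 : Site 3) L with hplate₀
  set F0 : Set (Site 3) := {x | x ∈ plate₀ ∧ x 0 = 0} with hF0
  set F1 : Set (Site 3) := {x | x ∈ plate₀ ∧ x 0 = L 0} with hF1
  set slab₀ : Finset (Site 3) := Finset.Icc (0 : Site 3) (easyShape k n) with hslab₀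
  set V₀ : Finset (Site 3) := Finset.Icc (0 : Site 3) ![2 * (n : ℤ), (k : ℤ) * (n : ℤ), (k : ℤ) * (n : ℤ)] with hV₀
  have hL0 : L 0 = 2 * (n : ℤ) := by simp [hL]
  -- shifts
  set w : Site 2 → Site 3 := fun b => ![(n : ℤ) * b 0, 2 * (n : ℤ) * b 1, 0] with hw
  set u : Site 2 → Site 3 := fun b => ![(n : ℤ) * b 0 + n, 2 * (n : ℤ) * b 1 - 2 * (n : ℤ), 0] with hu
  set f : Site 2 → Site 3 := fun b => ![(n : ℤ) * b 0, 2 * (n : ℤ) * b 1 - 2 * (n : ℤ), 0] with hf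
  have hw0 : ∀ b, w b 0 = (n : ℤ) * b 0 := fun b => by simp [hw]
  have hw1 : ∀ b, w b 1 = 2 * (n : ℤ) * b 1 := fun b => by simp [hw]
  have hw2 : ∀ b, w b 2 = 0 := fun b => by simp [hw]
  have hu0 : ∀ b, u b 0 = (n : ℤ) * b 0 + n := fun b => by simp [hu]
  -- cells
  set plate : Site 2 → Finset (Site 3) := fun b => plate₀.image (· + w b) with hplate
  set β : Site 2 → Finset (Site 3) := fun b => slab₀.image (· + u b) with hβ
  set V : Site 2 → Finset (Site 3) := fun b => V₀.image (· + f b) with hV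
  set C : Site 2 → Set (BondConfig (Site 3)) := fun b =>
    linked ((zdShiftIso (w b)) '' (↑plate₀ : Set (Site 3))) ((zdShiftIso (w b)) '' F0) ((zdShiftIso (w b)) '' F1) with hC
  set U : Site 2 → Set (BondConfig (Site 3)) := fun b =>
    {ω : BondConfig (Site 3) | ∀ x ∈ slab₀.image (· + u b), ∀ x' ∈ slab₀.image (· + u b), ∀ y ∈ slab₀.image (· + u b),
      ∀ y' ∈ slab₀.image (· + u b), x 0 = u b 0 → x' 0 = u b 0 → y 0 = u b 0 + (n : ℤ) → y' 0 = u b 0 + (n : ℤ) →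
      ω ∈ inConn ↑(slab₀.image (· + u b)) x y → ω ∈ inConn ↑(slab₀.image (· + u b)) x' y' →
      ω ∈ inConn ↑(slab₀.image (· + u b)) x x'} with hUdef
  set good : Site 2 → Set (BondConfig (Site 3)) := fun b => C b ∩ U b with hgood
  set src : Site 2 → Set (Site 3) := fun b => (zdShiftIso (w b)) '' F0 with hsrc
  set Wit : BondConfig (Site 3) → Site 2 → Site 3 → Prop := fun ω b x =>
    x 0 = (n : ℤ) * b 0 ∧ x ∈ plate b ∧ ∃ y : Site 3, y 0 = (n : ℤ) * b 0 + 2 * (n : ℤ) ∧ ω ∈ inConn ↑(plate b) x y with hWit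
  have himg_plate : ∀ b, (zdShiftIso (w b)) '' (↑plate₀ : Set (Site 3)) = ↑(plate b) := by
    intro b; simp only [hplate]; rw [Finset.coe_image]; rfl
  have hmem_plate₀ : ∀ x : Site 3, x ∈ plate₀ ↔
      (0 ≤ x 0 ∧ x 0 ≤ 2 * (n : ℤ)) ∧ (0 ≤ x 1 ∧ x 1 ≤ n) ∧ (0 ≤ x 2 ∧ x 2 ≤ (k : ℤ) * (n : ℤ)) := by
    intro x; rw [hplate₀, hL]; exact mem_Icc_zero_vec3_iff
  -- the source at the origin, as a finset
  set src₀ : Finset (Site 3) := (plate₀.filter fun x => x 0 = 0).image (· + w 0) with hsrc₀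
  have hsrc0 : src 0 = ↑src₀ := by
    simp only [hsrc, hsrc₀]
    rw [Finset.coe_image, Finset.coe_filter]
    ext x
    simp only [Set.mem_image, Set.mem_setOf_eq, hF0, zdShiftIso_apply]
  have hne : src₀.Nonempty := by
    refine (Finset.image_nonempty).2 ⟨0, ?_⟩
    rw [Finset.mem_filter, hmem_plate₀]
    refine ⟨?_, rfl⟩
    simp only [Pi.zero_apply]
    refine ⟨⟨le_rfl, by positivity⟩, ⟨le_rfl, hn0⟩, le_rfl, by positivity⟩
  -- smallness of `δ`
  have hδ0 : 0 ≤ δ := by rw [hδ]; positivity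
  have hδ1 : 2 * (((k : ℝ) + 1) ^ 2 + 2) * (2 * (3 ^ 2 + 1 : ℝ) ^ 2) ^ ((k + 1) ^ 2) * δ ≤ 1 := by
    have hpos : 0 < 2 * (((k : ℝ) + 1) ^ 2 + 2) * (2 * (3 ^ 2 + 1 : ℝ) ^ 2) ^ ((k + 1) ^ 2) := by positivity
    rw [hδ, mul_one_div_cancel hpos.ne']
  refine theta_pos_of_sparse_bound_wit p (src := src) (good := good) (Wit := Wit) src₀ hsrc0 hne ?_ ?_ ?_
    (r := k) hδ0 hδ1 ?_
  · -- a regular cell is crossed from its source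
    intro ω b hb
    obtain ⟨hcr, -⟩ := hb
    have hcr' : ω ∈ linked ((zdShiftIso (w b)) '' (↑plate₀ : Set (Site 3))) ((zdShiftIso (w b)) '' F0)
        ((zdShiftIso (w b)) '' F1) := hcr
    rw [mem_linked_iff] at hcr'
    obtain ⟨x, hx, _, ⟨y₀, ⟨hy₀, hy₀0⟩, rfl⟩, hxy⟩ := hcr'
    refine ⟨x, hx, ?_, ?_, (zdShiftIso (w b)) y₀, ?_, ?_⟩
    · obtain ⟨x₀, ⟨-, hx₀0⟩, rfl⟩ := hx
      rw [zdShiftIso_apply, Pi.add_apply, hx₀0, hw0, zero_add]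
    · obtain ⟨x₀, ⟨hx₀, -⟩, rfl⟩ := hx
      rw [← Finset.mem_coe, ← himg_plate b]
      exact ⟨x₀, Finset.mem_coe.2 hx₀, rfl⟩
    · rw [zdShiftIso_apply, Pi.add_apply, hy₀0, hL0, hw0]; ring
    · rw [← himg_plate b]; exact hxy
  · -- gluing of ★-neighbours
    intro ω b b' hbb' hb hb' x x' hWx hWx'
    obtain ⟨hx0, hx, y, hy0, hxy⟩ := hWx
    obtain ⟨hx'0, hx', y', hy'0, hx'y'⟩ := hWx'
    obtain ⟨⟨e0, e0'⟩, e1, e1'⟩ := mul_bounds_of_supDist_le_one (n := n) hbb'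
    rcases le_or_gt (b 0) (b' 0) with hle | hlt
    · have hkk : (n : ℤ) * b 0 ≤ (n : ℤ) * b' 0 := mul_le_mul_of_nonneg_left hle hn0
      exact reachable_of_slabUniq_plates_general (n := n) hk (k₀ := (n : ℤ) * b 0) (k₀' := (n : ℤ) * b' 0)
        (k₁ := 2 * (n : ℤ) * b 1) (k₁' := 2 * (n : ℤ) * b' 1) hkk (by linarith) (by linarith) (by linarith) hb.2 hx0 hy0 hx'0
        hy'0 hx hx' hxy hx'y'
    · have hkk : (n : ℤ) * b' 0 ≤ (n : ℤ) * b 0 := mul_le_mul_of_nonneg_left hlt.le hn0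
      exact (reachable_of_slabUniq_plates_general (n := n) hk (k₀ := (n : ℤ) * b' 0) (k₀' := (n : ℤ) * b 0)
        (k₁ := 2 * (n : ℤ) * b' 1) (k₁' := 2 * (n : ℤ) * b 1) hkk (by linarith) (by linarith) (by linarith)
        hb'.2 hx'0 hy'0 hx0 hy0 hx' hx hx'y' hxy).symm
  · -- distinct cells have disjoint sources
    intro b b' x hx hx'
    obtain ⟨a, ⟨ha, ha0⟩, rfl⟩ := hx
    obtain ⟨a', ⟨ha', ha'0⟩, he⟩ := hx'
    rw [zdShiftIso_apply] at he
    have he' : ∀ i, a' i + w b' i = a i + w b i := fun i => by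
      have := congrArg (fun z : Site 3 => z i) he; simpa [zdShiftIso_apply] using this
    have h0 := he' 0; have h1 := he' 1
    rw [hw0, hw0, ha0, ha'0, zero_add, zero_add] at h0
    rw [hw1, hw1] at h1
    obtain ⟨-, ⟨ha1, ha1'⟩, -⟩ := (hmem_plate₀ a).1 ha
    obtain ⟨-, ⟨ha'1, ha'1'⟩, -⟩ := (hmem_plate₀ a').1 ha'
    have hb0 : b 0 = b' 0 := by
      rcases lt_trichotomy (b 0) (b' 0) with hlt | heq | hgt
      · have : (n : ℤ) * b 0 < (n : ℤ) * b' 0 := mul_lt_mul_of_pos_left hlt hn1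
        omega
      · exact heq
      · have : (n : ℤ) * b' 0 < (n : ℤ) * b 0 := mul_lt_mul_of_pos_left hgt hn1
        omega
    have hb1 : b 1 = b' 1 := by
      rcases lt_trichotomy (b 1) (b' 1) with hlt | heq | hgt
      · have h2 : b 1 + 1 ≤ b' 1 := hlt
        have := mul_le_mul_of_nonneg_left h2 (by positivity : (0 : ℤ) ≤ 2 * (n : ℤ))
        nlinarith
      · exact heq
      · have h2 : b' 1 + 1 ≤ b 1 := hgt
        have := mul_le_mul_of_nonneg_left h2 (by positivity : (0 : ℤ) ≤ 2 * (n : ℤ))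
        nlinarith
    funext i
    fin_cases i
    · exact hb0
    · exact hb1
  · -- the sparse product bound
    intro T hT
    -- locality
    have hplateV : ∀ b, plate b ⊆ V b := by
      intro b x hx
      simp only [hplate, hV] at hx ⊢
      rw [mem_image_Icc_add_iff] at hx ⊢
      intro i
      have := hx i
      fin_cases i
      · simp [hL, hw, hf] at this ⊢; exact this
      · simp [hL, hw, hf] at this ⊢; constructor <;> linarith [this.1, this.2]
      · simp [hL, hw, hf] at this ⊢; exact this
    have hβV : ∀ b, β b ⊆ V b := by
      intro b x hx
      simp only [hβ, hV] at hx ⊢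
      rw [mem_image_Icc_add_iff] at hx ⊢
      intro i
      have := hx i
      fin_cases i
      · simp [easyShape, hu, hf] at this ⊢; constructor <;> linarith [this.1, this.2]
      · simp [easyShape, hu, hf] at this ⊢; exact this
      · simp [easyShape, hu, hf] at this ⊢; exact this
    have hdetC : ∀ b, DeterminedBy (C b) (↑(edgesIn (zdGraph 3) (V b)) : Set (Sym2 (Site 3))) := by
      intro b
      show DeterminedBy (linked ((zdShiftIso (w b)) '' (↑plate₀ : Set (Site 3))) ((zdShiftIso (w b)) '' F0)
        ((zdShiftIso (w b)) '' F1)) _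
      rw [himg_plate b]
      exact (determinedBy_linked_edgesIn (plate b) _ _).mono (coe_edgesIn_mono (hplateV b))
    have hdetU : ∀ b, DeterminedBy (U b) (↑(edgesIn (zdGraph 3) (V b)) : Set (Sym2 (Site 3))) := by
      intro b
      exact (determinedBy_slabUniqAt n (u b 0) (β b)).mono (coe_edgesIn_mono (hβV b))
    have hdet : ∀ b ∈ T, DeterminedBy (good b)ᶜ (↑(edgesIn (zdGraph 3) (V b)) : Set (Sym2 (Site 3))) :=
      fun b _ => ((hdetC b).inter (hdetU b)).compl'
    have hdisj : (↑T : Set (Site 2)).PairwiseDisjoint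
        (fun b => (↑(edgesIn (zdGraph 3) (V b)) : Set (Sym2 (Site 3)))) := by
      intro b hb b' hb' hne'
      exact disjoint_edgesIn_of_disjoint (disjoint_plateFootprint_of_lt_supDist_general hk hn (hT b hb b' hb' hne'))
    rw [bondPercolation_real_biInter_eq_prod (zdGraph 3) p T (fun b => (good b)ᶜ) _ hdet
      (fun b hb => (hdet b hb).measurableSet_of_finset) hdisj]
    -- each factor is at most `δ^16`
    have hCm : ∀ b, MeasurableSet (C b) := fun b => measurableSet_linked _ _ _
    have hUm : ∀ b, MeasurableSet (U b) := fun b => (determinedBy_slabUniqAt n (u b 0) (β b)).measurableSet_of_finset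
    have hPC : ∀ b, μ.real (C b)ᶜ ≤ μ.real (boxCross L 0)ᶜ := by
      intro b
      have himg := real_linked_image (zdShiftIso (w b)) p (↑plate₀ : Set (Site 3)) F0 F1
      rw [← hμ] at himg
      have e : μ.real (C b) = μ.real (linked (↑plate₀ : Set (Site 3)) F0 F1) := by rw [hC]; exact himg
      have hle : μ.real (boxCross L 0) ≤ μ.real (linked (↑plate₀ : Set (Site 3)) F0 F1) := by
        rw [hF0, hF1, hplate₀]; exact real_boxCross_le_real_linked_faces p L 0
      rw [probReal_compl_eq_one_sub (hCm b), probReal_compl_eq_one_sub (measurableSet_boxCross L 0), e]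
      linarith
    have hPU : ∀ b, μ.real (U b)ᶜ ≤ μ.real
        {ω : BondConfig (Site 3) | ∃ x ∈ slab₀, ∃ x' ∈ slab₀, ∃ y ∈ slab₀, ∃ y' ∈ slab₀,
          x 0 = 0 ∧ x' 0 = 0 ∧ y 0 = (n : ℤ) ∧ y' 0 = (n : ℤ) ∧
          ω ∈ inConn ↑slab₀ x y ∧ ω ∈ inConn ↑slab₀ x' y' ∧ ω ∉ inConn ↑slab₀ x x'} := by
      intro b
      have hrel := bondPercolation_real_preimage_relabel_iso (zdShiftIso (u b)) p (U b)ᶜ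
      rw [Set.preimage_compl] at hrel
      have hpre : BondConfig.relabel (sym2Equiv (zdShiftIso (u b)).toEquiv) ⁻¹' (U b) =
          {ω | ∀ x ∈ slab₀, ∀ x' ∈ slab₀, ∀ y ∈ slab₀, ∀ y' ∈ slab₀, x 0 = 0 → x' 0 = 0 → y 0 = (n : ℤ) → y' 0 = (n : ℤ) →
            ω ∈ inConn ↑slab₀ x y → ω ∈ inConn ↑slab₀ x' y' → ω ∈ inConn ↑slab₀ x x'} :=
        preimage_relabel_slabUniqAt n slab₀ (u b)
      rw [hpre, ← hμ] at hrel
      rw [← hrel]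
      exact measureReal_mono (compl_slabUniq_subset n slab₀) (measure_ne_top _ _)
    have hfac : ∀ b ∈ T, μ.real (good b)ᶜ ≤ δ ^ ((k + 1) ^ 2) := by
      intro b _
      have : μ.real (good b)ᶜ ≤ μ.real (C b)ᶜ + μ.real (U b)ᶜ := by
        simp only [hgood]; rw [Set.compl_inter]; exact measureReal_union_le _ _
      refine this.trans ((add_le_add (hPC b) (hPU b)).trans ?_)
      rw [hL]; exact h
    calc ∏ b ∈ T, μ.real (good b)ᶜ ≤ ∏ _b ∈ T, δ ^ ((k + 1) ^ 2) :=
          Finset.prod_le_prod (fun b _ => measureReal_nonneg) hfac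
      _ = δ ^ ((k + 1) ^ 2 * T.card) := by rw [Finset.prod_const, ← pow_mul]

end Summit.CriticalPhenomena.PercolationContinuityZ3.Theorems.Rsw3

end
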